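import Summits.QuantumFields.BalabanUV.T4Continuum.Support.ShellMeasureDecayRowsModelEnd
import Summits.QuantumFields.BalabanUV.T4Continuum.Support.ShellMeasureDecayRowsSupCells

/-!
# `T4Continuum.ShellMeasureDecayRowsModelEndSup` — ROW S124 = J-END, COMPANION «THE SUP-FIBRE MEMBER ON THE SLOT, `hreg`-FREE»:
# (E6)∕(E1) for the cell blocks of `(levelOp)⁻¹` on the slot's own two-level cube family read between SUP-NORMED cell fibres (S98: the
# coarse reading's «cell spaces sup-normed»; J1 (D9): the u-tuple's carrier is the (98) weighted-SUP pair), from IN-CELL PLAQUETTE-SMALLNESS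
# alone — leaf-04-g13's supplier `ShellMeasureDecayRowsSupCells.decayRow_levelOp_cells_sup_cov` (over beta-an4's
# `Beta/MultiscaleRegularityClosed.real_sup_levelOp_inverse_le`: the (3.42)₁ sup member, `hreg` DISCHARGED by lattice De Giorgi) FIRED BY NAME
(cell `pub-balaban`, sub-cell `t4`, spine estimate NE7c (node U5b); NE7c ROUND-2 crew `t4-ne7c-formalise-*`, unit
`b2b-balaban-t4-ne7c-formalise-leaf-02` gen 14; owner table ROW **S124 = J-END** (R-ne7cp1-g37-13 (b), journal l.24616; MINE l.24657; shape
l.24714 «f2»; leaf-04-g13's OFFER O-ne7cL04g13-1 filed as (A) on my word l.24798 — p244449 ✓); ADDITIVE — imports this row's f1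
`ShellMeasureDecayRowsModelEnd` (hence S119 f1, S117, S66 f3a, `Beta/MultiscaleGrowthCells`) and leaf-04-g13's `ShellMeasureDecayRowsSupCells`
(p244449 ✓) ONLY, everything BY NAME; touches NO host, moves NO census row; [folklore]; 0 `def`, 0 `def … : Prop`, 0 sorry, 0 citation
tags of Bałaban's.)

HONEST FRAMING.  Finite four-torus programme, rung (B)+1 only — NOT infinite volume, NOT a mass gap, NOT the Clay problem, NOT summit
progress; (B), `BetaPertHyp`, (B^μ) not consumed and NOT discharged.  NE7c (`T4IndicatorShell.ShellWeightBound`) is NOT PRINTED in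
[Balaban 1983–89] and NOT PROVED; «NE7c ⇐ the named binders» (trigger c3).  WHAT THIS IS ∕ IS NOT (R-ne7cp1-g37-13 (c)): (E6)∕(E1) in the
SUP-normed cell-fibre currency for the FULL inverse of the [B9] (3.24)-SHAPE MODEL operator with a CONSTANT bond weight `c ≡ c₀` (the
u-tuple's uniform `η⁻¹`, J1 (D1)) under E7's literal plaquette letters — the FIELD half of J1 (D9)'s (α3) residual, now binder-free at MODEL
level; NOT the gradient half (`|∇_{U₀}·|_{(−2)}` — no covariant-gradient member in `Beta/`), NOT the Dirichlet-sectioned inverse in the sup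
currency (the sup closers are for the full torus inverse), NOT Bałaban's `𝒢`∕`H₁`∕`H` (node O), rate `κ′ = κ − (1+d∕2)·log L∕R` (the sup
member's price); no ONE CALL row moves; nothing of Bałaban's instantiated, asserted, cited or discharged; census COUNT unchanged.
NORMALISATION (leaf-06-g10 INFO-2): the constant carries `(L·s)²` — level-free exactly for the `η_j²`-normalised inverse (J1 (D2)∕(D5)).
HONEST DEPENDENCY (cell): continuum YM on T⁴ ⇐ BetaPertH ∧ nine spine estimates (0/9 proved); BetaPertH ⇐ (D1) ∧ (D4) ∧ CAP+tail;
G-an2-4 gates asym, D1 and NE2/3/4.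

CONTENT (kernel).  §1 the slot family's CELL-LEVEL additive grading (`side_eq_pow`, `grading_add_cell`, `A = 1`).  §2 **(E6-sup)
`decayRow_inv_slot_sup_of_plaquettes`** = `ShellMeasureDecayRowsSupCells.decayRow_levelOp_cells_sup_cov` BY NAME on S117's family with S119 f1's
gauge datum (`cellGauge cellGauge_orth hgauge_of_plaquettes hloss_of_plaquettes`, `θg := 8d⁴α₀²`), `S_max := L·s`: for ALL cells
`‖blockSup c b′‖ ≤ (B_s·(L·s)²·e^{2dκ′})·exp(−(κ′·sdist (corner c) (corner b′)))`.  §3 **(E1-sup) `opNorm_kerOp_inv_slot_sup_of_plaquettes`**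
(+ pointwise `norm_kerOp_inv_slot_sup_apply_le` — added in v1.1, leaf-06-g11's DOCFIX-1: v1 promised it here without declaring it):
`‖kerOp blockSup‖ ≤ (B_s·(L·s)²·e^{2dκ′})·N₀Λ∕(1 − Λe^{−κ′})` — f1's `rowSum_sdist_slot` at the rate `κ′` + S66 f3a `opNorm_kerOp_le` BY NAME.  §4 RULE G-1 at `d = 4` (flat background, `c ≡ 1`, `κ = 10⁻³`, `L = 2`, `R = 10⁵`,
`ε = 10⁻⁴`; `hrate_d4`, `rate_sup_d4`) — every hypothesis discharged.
-/

noncomputable section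

open scoped BigOperators Matrix Matrix.Norms.L2Operator
open Finset Function

namespace Summit.QuantumFields.BalabanUV.T4Continuum.ShellMeasureDecayRowsModelEndSup

open Summit.QuantumFields.BalabanUV.Beta
open Summit.QuantumFields.BalabanUV.Beta.BoxPoincare (Box)
open Summit.QuantumFields.BalabanUV.Beta.CovariantBoxPoincare (hol succ)
open Summit.QuantumFields.BalabanUV.Beta.MultiscaleCoerciveTorus
open Summit.QuantumFields.BalabanUV.Beta.MultiscaleDecayBudget (siteScale cellOf)
open Summit.QuantumFields.BalabanUV.Beta.MultiscaleDistance (sdist sdist_nonneg)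
open Summit.QuantumFields.BalabanUV.Beta.SubsolutionMeanValueBox (Cmv)
open Summit.QuantumFields.BalabanUV.Beta.ThinLoopHolonomy (cpxHom)
open Summit.QuantumFields.BalabanUV.T4Continuum.ShellMeasureSlotCubeFamily
open Summit.QuantumFields.BalabanUV.T4Continuum.ShellMeasureDecayRowsLevelOpCellsSlot (side_le_coarse)
open Summit.QuantumFields.BalabanUV.T4Continuum.ShellMeasureCellGaugeFromPlaquettes
  (cellPlaq cellGauge cellGauge_orth hgauge_of_plaquettes hloss_of_plaquettes)
open Summit.QuantumFields.BalabanUV.T4Continuum.ShellMeasureDecayRowsSupCells (decayRow_levelOp_cells_sup_cov)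
open Summit.QuantumFields.BalabanUV.T4Continuum.ShellMeasureDecayRowsModelEnd
  (rowSum_sdist_slot norm_cellPlaq_flat_sub_one)
open Summit.QuantumFields.BalabanUV.T4Continuum.ShellMeasureDecayKernelSums (kerOp opNorm_kerOp_le)
open Literature.MathematicalPhysics.QuantumFieldTheory.Balaban1983to89
open Literature.MathematicalPhysics.QuantumFieldTheory.Balaban1983to89.B9Thm37GluePU (bsrc btgt)
open Literature.MathematicalPhysics.QuantumFieldTheory.Balaban1983to89.B9Thm37GlueTorusCov (tblk torusComb)
open Literature.MathematicalPhysics.QuantumFieldTheory.Balaban1983to89.B9Thm37GlueTorusCovLevels (levelOp)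
open B5TorusCover (UT Ctr ctrU nC)

variable {d : ℕ} [NeZero d] {N : Fin d → ℕ} [∀ i, NeZero (N i)] {Cp : Type} [Fintype Cp] [DecidableEq Cp] [Nonempty Cp]
variable {s L : ℕ} {Λ : Finset (Ctr N (L * s))} (hs : 1 ≤ s) (hL : 1 ≤ L) (hdiv : ∀ i, L * s ∣ N i)

/-! ## §1 The cell-level additive grading of the slot family (`A = 1`) -/

omit [NeZero d] [∀ i, NeZero (N i)] in
/-- **GRADED SIDES**: for `s = L^j` the two sides are `L^{e_l}` with `e_false = j` (the slot's cells), `e_true = j + 1` (the coarse cells).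
[folklore] -/
theorem side_eq_pow {j : ℕ} (hsj : s = L ^ j) (l : Bool) : side s L l = L ^ (if l = true then j + 1 else j) := by
  cases l
  · exact hsj
  · show L * s = L ^ (if true = true then j + 1 else j)
    rw [if_pos rfl, pow_succ, hsj, mul_comm]

omit [NeZero d] in
/-- **THE CELL-LEVEL ADDITIVE DATUM, `A = 1`**: the scale exponents of the cells of any two sites differ by at most `1 ≤ 1 + sdist∕R`.
[folklore] -/
theorem grading_add_cell {j : ℕ} {R : ℝ} (hR : 0 < R) (x y : UT N) :
    |(((if lvl (cellOf (side s L) (side_pos hs hL) (side_dvd hdiv) lvl (zc hs hL hdiv) (cells_cover (Λ := Λ) hs hL hdiv) x) = true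
          then j + 1 else j : ℕ) : ℝ)) -
        ((if lvl (cellOf (side s L) (side_pos hs hL) (side_dvd hdiv) lvl (zc hs hL hdiv) (cells_cover (Λ := Λ) hs hL hdiv) y) = true
          then j + 1 else j : ℕ) : ℝ)| ≤
      (1 : ℕ) + sdist bsrc btgt
        (siteScale (side s L) (side_pos hs hL) (side_dvd hdiv) lvl (zc hs hL hdiv) (cells_cover (Λ := Λ) hs hL hdiv)) x y / R := by
  have hsd : 0 ≤ sdist bsrc btgt
      (siteScale (side s L) (side_pos hs hL) (side_dvd hdiv) lvl (zc hs hL hdiv) (cells_cover (Λ := Λ) hs hL hdiv)) x y / R :=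
    div_nonneg (sdist_nonneg _ _ _ x y) hR.le
  have h1 : |(((if lvl (cellOf (side s L) (side_pos hs hL) (side_dvd hdiv) lvl (zc hs hL hdiv) (cells_cover (Λ := Λ) hs hL hdiv) x) =
        true then j + 1 else j : ℕ) : ℝ)) -
      ((if lvl (cellOf (side s L) (side_pos hs hL) (side_dvd hdiv) lvl (zc hs hL hdiv) (cells_cover (Λ := Λ) hs hL hdiv) y) = true
        then j + 1 else j : ℕ) : ℝ)| ≤ 1 := by
    split_ifs <;> push_cast <;> norm_num
  calc _ ≤ (1 : ℝ) := h1
    _ ≤ (1 : ℕ) + _ := by rw [Nat.cast_one]; linarith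

/-! ## §2 (E6) between SUP-normed cell fibres, from in-cell plaquette-smallness (`hreg`-free) -/

/-- **(E6-SUP) ON THE SLOT's OWN GEOMETRY, FROM E7's LITERAL SHAPE, `hreg`-FREE** (`ShellMeasureDecayRowsSupCells.decayRow_levelOp_cells_sup_cov`
BY NAME on S117's family — `cells_disjoint cells_cover meanProfile_supp scale_lo scale_hi`, graded sides `side_eq_pow` + `grading_add_cell`,
`S_max := L·s` — with S119 f1's gauge datum `cellGauge ∕ cellGauge_orth ∕ hgauge_of_plaquettes ∕ hloss_of_plaquettes`, `θg := 8d⁴α₀²`): for a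
CONSTANT bond weight `c ≡ c₀ ≠ 0` (`c_min ≤ |c₀| ≤ c_max`), column-orthonormal `Rm`, level coefficients `0 ≤ a_min ≤ α_l ≤ a_max`, in-cell
plaquette sizes `α_k ≥ 0` with `S_k²·α_k ≤ α₀` and `‖plaquette − 1‖ ≤ α_k`, graded sizes `s = L^j`, a rate `κ ∈ [0,1]` with `μ₀ > 0` and
`(1 + d∕2)·log L∕R ≤ κ`, `Γ = L¹·e^{(log L∕R)(4d+1)}`, `θ = 1∕(4dΓ)`, and ALL cells `c b′` of the slot family: the complexified SUP block of
`(levelOp)⁻¹` satisfies `‖blockSup c b′‖ ≤ (B_s·(L·s)²·e^{2dκ′})·exp(−(κ′·sdist (corner c) (corner b′)))`, `κ′ = κ − (1+d∕2)·log L∕R`,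
`B_s` = the supplier's constant VERBATIM. [folklore] -/
theorem decayRow_inv_slot_sup_of_plaquettes {j : ℕ} (hsj : s = L ^ j)
    (Rm : UT N × Fin d → Cp → Cp → ℝ) (hRm : ∀ b i j, ∑ k, Rm b k i * Rm b k j = if i = j then (1 : ℝ) else 0)
    {acoef : Bool → ℝ} {amin amax : ℝ} (hamin : 0 ≤ amin) (ha_lo : ∀ l, amin ≤ acoef l) (ha_hi : ∀ l, acoef l ≤ amax)
    (c : UT N × Fin d → ℝ) {c₀ : ℝ} (hcc : ∀ b, c b = c₀) (hc₀ : c₀ ≠ 0) {cmin cmax : ℝ} (hcmin : 0 < cmin) (hc_lo : ∀ b, cmin ≤ |c b|)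
    (hc_hi : ∀ b, |c b| ≤ cmax)
    (α : Cell s L Λ → ℝ) (hα : ∀ k, 0 ≤ α k) {α₀ : ℝ} (hαS : ∀ k, (side s L (lvl k) : ℝ) ^ 2 * α k ≤ α₀)
    (hplaq : ∀ (k : Cell s L Λ) (v : Box d (side s L (lvl k))) (κ μ : Fin d) (hκ : (v κ : ℕ) + 1 < side s L (lvl k))
      (hμ : (v μ : ℕ) + 1 < side s L (lvl k)), κ ≠ μ →
        ‖cpxHom (cellPlaq (side s L) (side_pos hs hL) (side_dvd hdiv) lvl (zc hs hL hdiv) Rm k v κ μ hκ hμ) - 1‖ ≤ α k)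
    {κ : ℝ} (hκ0 : 0 ≤ κ) (hκ1 : κ ≤ 1)
    (hμ : 0 < (1 - 8 * (d : ℝ) ^ 4 * α₀ ^ 2) * min (cmin ^ 2 / (4 * d)) (amin / 4) - 2 * d * cmax ^ 2 * κ ^ 2 -
      amax * (Real.exp (2 * d * κ) - 1))
    {R : ℝ} (hR : 0 < R) (hrate : (1 + d / 2) * (Real.log L / R) ≤ κ)
    {Γ θ : ℝ} (hΓ : Γ = (L : ℝ) ^ (1 : ℕ) * Real.exp (Real.log L / R * (4 * d + 1))) (hθ : θ = 1 / (4 * d * Γ))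
    (cc b' : Cell s L Λ) :
    ‖(LinearMap.toContinuousLinearMap (Matrix.mulVecLin
        ((Matrix.of fun p q : UT N × Cp =>
          if cellOf (side s L) (side_pos hs hL) (side_dvd hdiv) lvl (zc hs hL hdiv) (cells_cover (Λ := Λ) hs hL hdiv) p.1 = cc ∧
              cellOf (side s L) (side_pos hs hL) (side_dvd hdiv) lvl (zc hs hL hdiv) (cells_cover (Λ := Λ) hs hL hdiv) q.1 = b' then
            (Ring.inverse (levelOp bsrc btgt c Rm (fun l x => ctrU N (side s L l) (tblk (side_pos hs hL l) (side_dvd hdiv l) x))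
              (fun l x => meanProfile hs hL hdiv Λ l (ctrU N (side s L l) (tblk (side_pos hs hL l) (side_dvd hdiv l) x)))
              (fun l x => (torusComb (side_pos hs hL l) (side_dvd hdiv l)).tr Rm x) (treeWeight d s L acoef))) (Pi.single q 1) p
          else 0).map Complex.ofReal)) : (UT N × Cp → ℂ) →L[ℂ] (UT N × Cp → ℂ))‖ ≤
      (((max (Real.sqrt (11 ^ d)) (Cmv d * Real.sqrt (21 ^ d)) / Real.sqrt (θ ^ d) +
            Real.sqrt (Fintype.card Cp) * (θ + 1) ^ 2 * (amax * Γ ^ 2 * Real.sqrt (Γ ^ d)) / (2 * c₀ ^ 2)) *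
          (Real.sqrt (Fintype.card Cp) * Real.exp (κ * ((4 * d + 1) + 2 * d)) *
            ((L : ℝ) ^ (1 : ℕ) * Real.exp (Real.log L / R * (4 * d + 1))) * (L : ℝ) ^ (1 : ℕ) * Real.sqrt (((L : ℝ) ^ (1 : ℕ)) ^ d) /
            ((1 - 8 * (d : ℝ) ^ 4 * α₀ ^ 2) * min (cmin ^ 2 / (4 * d)) (amin / 4) - 2 * d * cmax ^ 2 * κ ^ 2 -
              amax * (Real.exp (2 * d * κ) - 1))) +
          Real.sqrt (Fintype.card Cp) * (θ + 1) ^ 2 / (2 * c₀ ^ 2) *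
            Real.exp ((κ - (1 + d / 2) * (Real.log L / R)) * ((4 * d + 1) + 2 * d))) *
        ((L * s : ℕ) : ℝ) ^ 2 * Real.exp (2 * d * (κ - (1 + d / 2) * (Real.log L / R)))) *
        Real.exp (-((κ - (1 + d / 2) * (Real.log L / R)) * sdist bsrc btgt
          (siteScale (side s L) (side_pos hs hL) (side_dvd hdiv) lvl (zc hs hL hdiv) (cells_cover (Λ := Λ) hs hL hdiv))
          (ctrU N (side s L (lvl cc)) (zc hs hL hdiv cc)) (ctrU N (side s L (lvl b')) (zc hs hL hdiv b')))) :=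
  decayRow_levelOp_cells_sup_cov (side s L) (side_pos hs hL) (side_dvd hdiv) lvl (zc hs hL hdiv) (cells_disjoint hs hL hdiv)
    (cells_cover hs hL hdiv) Rm hRm (treeWeight d s L acoef) (treeWeight_nonneg fun l => hamin.trans (ha_lo l))
    (meanProfile hs hL hdiv Λ) (meanProfile_supp hs hL hdiv) (hamin.trans ((ha_lo true).trans (ha_hi true))) (scale_hi hs hL hdiv ha_hi)
    c hcc hc₀ hL (fun l => if l = true then j + 1 else j) (side_eq_pow hsj) hR (grading_add_cell hs hL hdiv hR) hc_hi hamin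
    (scale_lo hs hL hdiv ha_lo) hcmin hc_lo
    (cellGauge (side s L) (side_pos hs hL) (side_dvd hdiv) lvl (zc hs hL hdiv) Rm hRm)
    (cellGauge_orth (side s L) (side_pos hs hL) (side_dvd hdiv) lvl (zc hs hL hdiv) Rm hRm)
    (fun k => d * ((side s L (lvl k) : ℝ) - 1) * α k)
    (fun k => by
      have hs1 : (1 : ℝ) ≤ side s L (lvl k) := by exact_mod_cast side_pos hs hL (lvl k)
      have := hα k
      have : (0 : ℝ) ≤ (side s L (lvl k) : ℝ) - 1 := by linarith
      positivity)
    (fun k v i hv u => hgauge_of_plaquettes (side s L) (side_pos hs hL) (side_dvd hdiv) lvl (zc hs hL hdiv) Rm hRm k (hα k) (hplaq k) v i hv u)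
    (fun k => hloss_of_plaquettes (side s L) (side_pos hs hL) lvl α hα hαS k) hκ0 hκ1 hμ hrate hΓ hθ
    (fun k => side_le_coarse hL (lvl k)) cc b'

/-! ## §3 (E1) between SUP-normed cell fibres -/

/-- **(E1-SUP) FROM (E6-SUP) + f1's VOLUME-FREE ROW SUM AT THE RATE `κ′`** (S66 f3a `opNorm_kerOp_le` BY NAME): under §2's hypotheses, any
`ε > 0` and the rate condition `e^{ε + 2(log L∕R)d}·e^{−κ′} < 1`: `‖kerOp blockSup‖ ≤ (B_s·(L·s)²·e^{2dκ′})·N₀Λ∕(1 − Λe^{−κ′})`. [folklore] -/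
theorem opNorm_kerOp_inv_slot_sup_of_plaquettes {j : ℕ} (hsj : s = L ^ j)
    (Rm : UT N × Fin d → Cp → Cp → ℝ) (hRm : ∀ b i j, ∑ k, Rm b k i * Rm b k j = if i = j then (1 : ℝ) else 0)
    {acoef : Bool → ℝ} {amin amax : ℝ} (hamin : 0 ≤ amin) (ha_lo : ∀ l, amin ≤ acoef l) (ha_hi : ∀ l, acoef l ≤ amax)
    (c : UT N × Fin d → ℝ) {c₀ : ℝ} (hcc : ∀ b, c b = c₀) (hc₀ : c₀ ≠ 0) {cmin cmax : ℝ} (hcmin : 0 < cmin) (hc_lo : ∀ b, cmin ≤ |c b|)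
    (hc_hi : ∀ b, |c b| ≤ cmax)
    (α : Cell s L Λ → ℝ) (hα : ∀ k, 0 ≤ α k) {α₀ : ℝ} (hαS : ∀ k, (side s L (lvl k) : ℝ) ^ 2 * α k ≤ α₀)
    (hplaq : ∀ (k : Cell s L Λ) (v : Box d (side s L (lvl k))) (κ μ : Fin d) (hκ : (v κ : ℕ) + 1 < side s L (lvl k))
      (hμ : (v μ : ℕ) + 1 < side s L (lvl k)), κ ≠ μ →
        ‖cpxHom (cellPlaq (side s L) (side_pos hs hL) (side_dvd hdiv) lvl (zc hs hL hdiv) Rm k v κ μ hκ hμ) - 1‖ ≤ α k)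
    {κ : ℝ} (hκ0 : 0 ≤ κ) (hκ1 : κ ≤ 1)
    (hμ : 0 < (1 - 8 * (d : ℝ) ^ 4 * α₀ ^ 2) * min (cmin ^ 2 / (4 * d)) (amin / 4) - 2 * d * cmax ^ 2 * κ ^ 2 -
      amax * (Real.exp (2 * d * κ) - 1))
    {R : ℝ} (hR : 0 < R) (hrate : (1 + d / 2) * (Real.log L / R) ≤ κ)
    {Γ θ : ℝ} (hΓ : Γ = (L : ℝ) ^ (1 : ℕ) * Real.exp (Real.log L / R * (4 * d + 1))) (hθ : θ = 1 / (4 * d * Γ))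
    {ε : ℝ} (hε : 0 < ε) (hq : Real.exp (ε + 2 * (Real.log L / R) * d) * Real.exp (-(κ - (1 + d / 2) * (Real.log L / R))) < 1) :
    ‖kerOp (𝕜 := ℂ) (fun cc b' : Cell s L Λ => (LinearMap.toContinuousLinearMap (Matrix.mulVecLin
        ((Matrix.of fun p q : UT N × Cp =>
          if cellOf (side s L) (side_pos hs hL) (side_dvd hdiv) lvl (zc hs hL hdiv) (cells_cover (Λ := Λ) hs hL hdiv) p.1 = cc ∧
              cellOf (side s L) (side_pos hs hL) (side_dvd hdiv) lvl (zc hs hL hdiv) (cells_cover (Λ := Λ) hs hL hdiv) q.1 = b' then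
            (Ring.inverse (levelOp bsrc btgt c Rm (fun l x => ctrU N (side s L l) (tblk (side_pos hs hL l) (side_dvd hdiv l) x))
              (fun l x => meanProfile hs hL hdiv Λ l (ctrU N (side s L l) (tblk (side_pos hs hL l) (side_dvd hdiv l) x)))
              (fun l x => (torusComb (side_pos hs hL l) (side_dvd hdiv l)).tr Rm x) (treeWeight d s L acoef))) (Pi.single q 1) p
          else 0).map Complex.ofReal)) : (UT N × Cp → ℂ) →L[ℂ] (UT N × Cp → ℂ)))‖ ≤
      (((max (Real.sqrt (11 ^ d)) (Cmv d * Real.sqrt (21 ^ d)) / Real.sqrt (θ ^ d) +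
            Real.sqrt (Fintype.card Cp) * (θ + 1) ^ 2 * (amax * Γ ^ 2 * Real.sqrt (Γ ^ d)) / (2 * c₀ ^ 2)) *
          (Real.sqrt (Fintype.card Cp) * Real.exp (κ * ((4 * d + 1) + 2 * d)) *
            ((L : ℝ) ^ (1 : ℕ) * Real.exp (Real.log L / R * (4 * d + 1))) * (L : ℝ) ^ (1 : ℕ) * Real.sqrt (((L : ℝ) ^ (1 : ℕ)) ^ d) /
            ((1 - 8 * (d : ℝ) ^ 4 * α₀ ^ 2) * min (cmin ^ 2 / (4 * d)) (amin / 4) - 2 * d * cmax ^ 2 * κ ^ 2 -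
              amax * (Real.exp (2 * d * κ) - 1))) +
          Real.sqrt (Fintype.card Cp) * (θ + 1) ^ 2 / (2 * c₀ ^ 2) *
            Real.exp ((κ - (1 + d / 2) * (Real.log L / R)) * ((4 * d + 1) + 2 * d))) *
        ((L * s : ℕ) : ℝ) ^ 2 * Real.exp (2 * d * (κ - (1 + d / 2) * (Real.log L / R)))) *
        ((3 * ((L : ℝ) ^ (1 : ℕ)) ^ 2) ^ d * ((d.factorial : ℝ) / ε ^ d) * Real.exp (2 * d * (ε + Real.log L / R * d)) *
            Real.exp (ε + 2 * (Real.log L / R) * d) /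
          (1 - Real.exp (ε + 2 * (Real.log L / R) * d) * Real.exp (-(κ - (1 + d / 2) * (Real.log L / R))))) := by
  have hκ' : 0 ≤ κ - (1 + d / 2) * (Real.log L / R) := sub_nonneg.mpr hrate
  have hq1 : 0 < 1 - Real.exp (ε + 2 * (Real.log L / R) * d) * Real.exp (-(κ - (1 + d / 2) * (Real.log L / R))) := by linarith
  have hM : 0 ≤ (3 * ((L : ℝ) ^ (1 : ℕ)) ^ 2) ^ d * ((d.factorial : ℝ) / ε ^ d) * Real.exp (2 * d * (ε + Real.log L / R * d)) *
      Real.exp (ε + 2 * (Real.log L / R) * d) /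
      (1 - Real.exp (ε + 2 * (Real.log L / R) * d) * Real.exp (-(κ - (1 + d / 2) * (Real.log L / R)))) := by positivity
  -- the (E6-sup) constant is nonnegative (all factors are)
  have hamax : 0 ≤ amax := hamin.trans ((ha_lo true).trans (ha_hi true))
  have hC : 0 ≤ ((max (Real.sqrt (11 ^ d)) (Cmv d * Real.sqrt (21 ^ d)) / Real.sqrt (θ ^ d) +
            Real.sqrt (Fintype.card Cp) * (θ + 1) ^ 2 * (amax * Γ ^ 2 * Real.sqrt (Γ ^ d)) / (2 * c₀ ^ 2)) *
          (Real.sqrt (Fintype.card Cp) * Real.exp (κ * ((4 * d + 1) + 2 * d)) *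
            ((L : ℝ) ^ (1 : ℕ) * Real.exp (Real.log L / R * (4 * d + 1))) * (L : ℝ) ^ (1 : ℕ) * Real.sqrt (((L : ℝ) ^ (1 : ℕ)) ^ d) /
            ((1 - 8 * (d : ℝ) ^ 4 * α₀ ^ 2) * min (cmin ^ 2 / (4 * d)) (amin / 4) - 2 * d * cmax ^ 2 * κ ^ 2 -
              amax * (Real.exp (2 * d * κ) - 1))) +
          Real.sqrt (Fintype.card Cp) * (θ + 1) ^ 2 / (2 * c₀ ^ 2) *
            Real.exp ((κ - (1 + d / 2) * (Real.log L / R)) * ((4 * d + 1) + 2 * d))) *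
        ((L * s : ℕ) : ℝ) ^ 2 * Real.exp (2 * d * (κ - (1 + d / 2) * (Real.log L / R))) := by
    have hμ' := hμ.le
    have hmax : 0 ≤ max (Real.sqrt (11 ^ d)) (Cmv d * Real.sqrt (21 ^ d)) := le_max_of_le_left (Real.sqrt_nonneg _)
    positivity
  refine opNorm_kerOp_le _ (mul_nonneg hC hM) fun cc => ?_
  calc _ ≤ ∑ b' : Cell s L Λ, (((max (Real.sqrt (11 ^ d)) (Cmv d * Real.sqrt (21 ^ d)) / Real.sqrt (θ ^ d) +
            Real.sqrt (Fintype.card Cp) * (θ + 1) ^ 2 * (amax * Γ ^ 2 * Real.sqrt (Γ ^ d)) / (2 * c₀ ^ 2)) *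
          (Real.sqrt (Fintype.card Cp) * Real.exp (κ * ((4 * d + 1) + 2 * d)) *
            ((L : ℝ) ^ (1 : ℕ) * Real.exp (Real.log L / R * (4 * d + 1))) * (L : ℝ) ^ (1 : ℕ) * Real.sqrt (((L : ℝ) ^ (1 : ℕ)) ^ d) /
            ((1 - 8 * (d : ℝ) ^ 4 * α₀ ^ 2) * min (cmin ^ 2 / (4 * d)) (amin / 4) - 2 * d * cmax ^ 2 * κ ^ 2 -
              amax * (Real.exp (2 * d * κ) - 1))) +
          Real.sqrt (Fintype.card Cp) * (θ + 1) ^ 2 / (2 * c₀ ^ 2) *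
            Real.exp ((κ - (1 + d / 2) * (Real.log L / R)) * ((4 * d + 1) + 2 * d))) *
        ((L * s : ℕ) : ℝ) ^ 2 * Real.exp (2 * d * (κ - (1 + d / 2) * (Real.log L / R)))) *
        Real.exp (-((κ - (1 + d / 2) * (Real.log L / R)) * sdist bsrc btgt
          (siteScale (side s L) (side_pos hs hL) (side_dvd hdiv) lvl (zc hs hL hdiv) (cells_cover (Λ := Λ) hs hL hdiv))
          (ctrU N (side s L (lvl cc)) (zc hs hL hdiv cc)) (ctrU N (side s L (lvl b')) (zc hs hL hdiv b')))) :=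
        Finset.sum_le_sum fun b' _ => decayRow_inv_slot_sup_of_plaquettes hs hL hdiv hsj Rm hRm hamin ha_lo ha_hi c hcc hc₀ hcmin hc_lo
          hc_hi α hα hαS hplaq hκ0 hκ1 hμ hR hrate hΓ hθ cc b'
    _ = _ * ∑ b' : Cell s L Λ, Real.exp (-((κ - (1 + d / 2) * (Real.log L / R)) * sdist bsrc btgt
          (siteScale (side s L) (side_pos hs hL) (side_dvd hdiv) lvl (zc hs hL hdiv) (cells_cover (Λ := Λ) hs hL hdiv))
          (ctrU N (side s L (lvl cc)) (zc hs hL hdiv cc)) (ctrU N (side s L (lvl b')) (zc hs hL hdiv b')))) := by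
        rw [Finset.mul_sum]
    _ ≤ _ := mul_le_mul_of_nonneg_left (rowSum_sdist_slot hs hL hdiv hsj hε hR hκ' hq cc) hC

/-- **(E1-SUP) POINTWISE — THE HOST's SHAPE `∀ f, ‖kerOp blockSup f‖ ≤ B₀·‖f‖`** (one `le_opNorm` line over
`opNorm_kerOp_inv_slot_sup_of_plaquettes`; v1.1, leaf-06-g11's DOCFIX-1: the header promised this corollary). [folklore] -/
theorem norm_kerOp_inv_slot_sup_apply_le {j : ℕ} (hsj : s = L ^ j)
    (Rm : UT N × Fin d → Cp → Cp → ℝ) (hRm : ∀ b i j, ∑ k, Rm b k i * Rm b k j = if i = j then (1 : ℝ) else 0)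
    {acoef : Bool → ℝ} {amin amax : ℝ} (hamin : 0 ≤ amin) (ha_lo : ∀ l, amin ≤ acoef l) (ha_hi : ∀ l, acoef l ≤ amax)
    (c : UT N × Fin d → ℝ) {c₀ : ℝ} (hcc : ∀ b, c b = c₀) (hc₀ : c₀ ≠ 0) {cmin cmax : ℝ} (hcmin : 0 < cmin) (hc_lo : ∀ b, cmin ≤ |c b|)
    (hc_hi : ∀ b, |c b| ≤ cmax)
    (α : Cell s L Λ → ℝ) (hα : ∀ k, 0 ≤ α k) {α₀ : ℝ} (hαS : ∀ k, (side s L (lvl k) : ℝ) ^ 2 * α k ≤ α₀)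
    (hplaq : ∀ (k : Cell s L Λ) (v : Box d (side s L (lvl k))) (κ μ : Fin d) (hκ : (v κ : ℕ) + 1 < side s L (lvl k))
      (hμ : (v μ : ℕ) + 1 < side s L (lvl k)), κ ≠ μ →
        ‖cpxHom (cellPlaq (side s L) (side_pos hs hL) (side_dvd hdiv) lvl (zc hs hL hdiv) Rm k v κ μ hκ hμ) - 1‖ ≤ α k)
    {κ : ℝ} (hκ0 : 0 ≤ κ) (hκ1 : κ ≤ 1)
    (hμ : 0 < (1 - 8 * (d : ℝ) ^ 4 * α₀ ^ 2) * min (cmin ^ 2 / (4 * d)) (amin / 4) - 2 * d * cmax ^ 2 * κ ^ 2 -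
      amax * (Real.exp (2 * d * κ) - 1))
    {R : ℝ} (hR : 0 < R) (hrate : (1 + d / 2) * (Real.log L / R) ≤ κ)
    {Γ θ : ℝ} (hΓ : Γ = (L : ℝ) ^ (1 : ℕ) * Real.exp (Real.log L / R * (4 * d + 1))) (hθ : θ = 1 / (4 * d * Γ))
    {ε : ℝ} (hε : 0 < ε) (hq : Real.exp (ε + 2 * (Real.log L / R) * d) * Real.exp (-(κ - (1 + d / 2) * (Real.log L / R))) < 1)
    (f : Cell s L Λ → (UT N × Cp → ℂ)) :
    ‖kerOp (𝕜 := ℂ) (fun cc b' : Cell s L Λ => (LinearMap.toContinuousLinearMap (Matrix.mulVecLin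
        ((Matrix.of fun p q : UT N × Cp =>
          if cellOf (side s L) (side_pos hs hL) (side_dvd hdiv) lvl (zc hs hL hdiv) (cells_cover (Λ := Λ) hs hL hdiv) p.1 = cc ∧
              cellOf (side s L) (side_pos hs hL) (side_dvd hdiv) lvl (zc hs hL hdiv) (cells_cover (Λ := Λ) hs hL hdiv) q.1 = b' then
            (Ring.inverse (levelOp bsrc btgt c Rm (fun l x => ctrU N (side s L l) (tblk (side_pos hs hL l) (side_dvd hdiv l) x))
              (fun l x => meanProfile hs hL hdiv Λ l (ctrU N (side s L l) (tblk (side_pos hs hL l) (side_dvd hdiv l) x)))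
              (fun l x => (torusComb (side_pos hs hL l) (side_dvd hdiv l)).tr Rm x) (treeWeight d s L acoef))) (Pi.single q 1) p
          else 0).map Complex.ofReal)) : (UT N × Cp → ℂ) →L[ℂ] (UT N × Cp → ℂ))) f‖ ≤
      (((max (Real.sqrt (11 ^ d)) (Cmv d * Real.sqrt (21 ^ d)) / Real.sqrt (θ ^ d) +
            Real.sqrt (Fintype.card Cp) * (θ + 1) ^ 2 * (amax * Γ ^ 2 * Real.sqrt (Γ ^ d)) / (2 * c₀ ^ 2)) *
          (Real.sqrt (Fintype.card Cp) * Real.exp (κ * ((4 * d + 1) + 2 * d)) *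
            ((L : ℝ) ^ (1 : ℕ) * Real.exp (Real.log L / R * (4 * d + 1))) * (L : ℝ) ^ (1 : ℕ) * Real.sqrt (((L : ℝ) ^ (1 : ℕ)) ^ d) /
            ((1 - 8 * (d : ℝ) ^ 4 * α₀ ^ 2) * min (cmin ^ 2 / (4 * d)) (amin / 4) - 2 * d * cmax ^ 2 * κ ^ 2 -
              amax * (Real.exp (2 * d * κ) - 1))) +
          Real.sqrt (Fintype.card Cp) * (θ + 1) ^ 2 / (2 * c₀ ^ 2) *
            Real.exp ((κ - (1 + d / 2) * (Real.log L / R)) * ((4 * d + 1) + 2 * d))) *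
        ((L * s : ℕ) : ℝ) ^ 2 * Real.exp (2 * d * (κ - (1 + d / 2) * (Real.log L / R)))) *
        ((3 * ((L : ℝ) ^ (1 : ℕ)) ^ 2) ^ d * ((d.factorial : ℝ) / ε ^ d) * Real.exp (2 * d * (ε + Real.log L / R * d)) *
            Real.exp (ε + 2 * (Real.log L / R) * d) /
          (1 - Real.exp (ε + 2 * (Real.log L / R) * d) * Real.exp (-(κ - (1 + d / 2) * (Real.log L / R))))) * ‖f‖ :=
  (ContinuousLinearMap.le_opNorm _ f).trans (mul_le_mul_of_nonneg_right
    (opNorm_kerOp_inv_slot_sup_of_plaquettes hs hL hdiv hsj Rm hRm hamin ha_lo ha_hi c hcc hc₀ hcmin hc_lo hc_hi α hα hαS hplaq hκ0 hκ1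
      hμ hR hrate hΓ hθ hε hq) (norm_nonneg f))

/-! ## §4 RULE G-1 at `d = 4`: flat background, constant unit bond weight -/

/-- THE NUMBERS (iii): the sup member's rate price at `d = 4`, `L = 2`, `R = 10⁵`, `κ = 10⁻³`: `(1 + 4∕2)·(log 2∕10⁵) ≤ 10⁻³`. [folklore] -/
theorem hrate_d4 : (1 + ((4 : ℕ) : ℝ) / 2) * (Real.log (2 : ℕ) / 100000) ≤ (1 / 1000 : ℝ) := by
  have hlog : Real.log (2 : ℕ) ≤ 1 := by
    have := Real.log_two_lt_d9
    push_cast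
    linarith
  have hlog0 : 0 ≤ Real.log (2 : ℕ) := Real.log_nonneg (by norm_num)
  push_cast at hlog hlog0 ⊢
  nlinarith

/-- THE NUMBERS (iv): the rate condition at the reduced rate `κ′ = κ − 3·log 2∕10⁵`, `ε = 10⁻⁴`. [folklore] -/
theorem rate_sup_d4 : Real.exp ((1 / 10000 : ℝ) + 2 * (Real.log (2 : ℕ) / 100000) * ((4 : ℕ) : ℝ)) *
    Real.exp (-((1 / 1000 : ℝ) - (1 + ((4 : ℕ) : ℝ) / 2) * (Real.log (2 : ℕ) / 100000))) < 1 := by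
  rw [← Real.exp_add]
  have hlog : Real.log (2 : ℕ) ≤ 1 := by
    have := Real.log_two_lt_d9
    push_cast
    linarith
  have hlog0 : 0 ≤ Real.log (2 : ℕ) := Real.log_nonneg (by norm_num)
  have hneg : (1 / 10000 : ℝ) + 2 * (Real.log (2 : ℕ) / 100000) * ((4 : ℕ) : ℝ) +
      -((1 / 1000 : ℝ) - (1 + ((4 : ℕ) : ℝ) / 2) * (Real.log (2 : ℕ) / 100000)) < 0 := by
    push_cast at hlog hlog0 ⊢
    nlinarith
  exact Real.exp_lt_one_iff.2 hneg

/-- **RULE G-1, (E6-sup)**: FIRES on the `d = 4` slot family (torus `4⁴`, `s = 1 = 2⁰`, `L = 2`, ANY slot, fibre `Unit`, `c ≡ 1`, `acoef ≡ 1`,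
`κ = 10⁻³`, `R = 10⁵`) at the FLAT background (E7 with `α ≡ 0`) for EVERY pair of cells — every hypothesis discharged. [folklore] -/
example (Λ : Finset (Ctr (fun _ : Fin 4 => 4) (2 * 1))) (cc b' : Cell 1 2 Λ) :=
  decayRow_inv_slot_sup_of_plaquettes (Cp := Unit) (Λ := Λ) le_rfl (by norm_num) (fun _ => ⟨2, rfl⟩) (j := 0) (by norm_num)
    (fun _ => oneM) (fun _ i j => oneM_orth i j) (acoef := fun _ => 1) (amin := 1) (amax := 1) zero_le_one (fun _ => le_rfl)
    (fun _ => le_rfl) (fun _ => 1) (c₀ := 1) (fun _ => rfl) one_ne_zero (cmin := 1) (cmax := 1) one_pos (fun _ => by simp)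
    (fun _ => by simp) (fun _ => 0) (fun _ => le_rfl) (α₀ := 0) (fun _ => by simp)
    (fun k v κ μ hκ hμ _ => norm_cellPlaq_flat_sub_one k v κ μ hκ hμ) (κ := 1 / 1000) (by norm_num) (by norm_num)
    ShellMeasureDecayRowsModelEnd.mu0_pos_d4 (R := 100000) (by norm_num) hrate_d4 rfl rfl cc b'

/-- **RULE G-1, (E1-sup)**: the bounded kernel operator FIRES on the same data (`ε = 10⁻⁴`). [folklore] -/
example (Λ : Finset (Ctr (fun _ : Fin 4 => 4) (2 * 1))) :=
  opNorm_kerOp_inv_slot_sup_of_plaquettes (Cp := Unit) (Λ := Λ) le_rfl (by norm_num) (fun _ => ⟨2, rfl⟩) (j := 0) (by norm_num)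
    (fun _ => oneM) (fun _ i j => oneM_orth i j) (acoef := fun _ => 1) (amin := 1) (amax := 1) zero_le_one (fun _ => le_rfl)
    (fun _ => le_rfl) (fun _ => 1) (c₀ := 1) (fun _ => rfl) one_ne_zero (cmin := 1) (cmax := 1) one_pos (fun _ => by simp)
    (fun _ => by simp) (fun _ => 0) (fun _ => le_rfl) (α₀ := 0) (fun _ => by simp)
    (fun k v κ μ hκ hμ _ => norm_cellPlaq_flat_sub_one k v κ μ hκ hμ) (κ := 1 / 1000) (by norm_num) (by norm_num)
    ShellMeasureDecayRowsModelEnd.mu0_pos_d4 (R := 100000) (by norm_num) hrate_d4 rfl rfl (ε := 1 / 10000) (by norm_num) rate_sup_d4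

end Summit.QuantumFields.BalabanUV.T4Continuum.ShellMeasureDecayRowsModelEndSup

end
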